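import Summits.QuantumAdvantage.QuantumAdvantage.Theorems.WalkThreeStepFlip
import Summits.QuantumAdvantage.QuantumAdvantage.Theorems.WalkTwoStepDensePeelFrame

/-!
# Rung (G♯₂) `ThreeStepFreeRungFive` (item stmt-QuantumAdvantage-23286), architecture (U), 1/3: objects and the RESIDUE PROFILE

Cell qa-qnc0, route OddPrimeWalk, support item stmt-QuantumAdvantage-23286 (planner qa-qnc0-p2 g27, ROUND-27 §3.3/§4, sketch
`HOME/qa-qnc0-p2/line27/RungUSketch.lean`); prover qn-prover-3 g16.

A position `τ` of a three-step strategy `S` is DEGENERATE (`RungU.Degenerate`) when the adjacent transposition `cornerFlip n τ`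
(swap the bits `τ − 1`, `τ`) never changes the outcome of the u-walk game.  Architecture (U) ("usable-or-rigid") proves the rung
from: U-a one non-degenerate position of bounded co-split forces a constant loss; U-b few hub positions; U-c/U-d rigidity of long
degenerate stretches (three-weights law); U-e averaging.  THIS MODULE: §0 the objects of the sketch (`Degenerate`, `coSplit`,
`winCount`, the module statements `UsableBound`, `HubCount` VERBATIM); §1 **the discordance bit `discBit3 c S τ u` is a function of
the residue profile of `u`** — the prefix counts `N(x) mod 3p` at the positions read by the observers of `τ` (their positions and two
splits, truncated at `n`), at `τ − 1, τ, τ + 1` and at `n` (`status3_congr`, `sameRes_cornerFlip`, `discBit3_congr`); the profile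
has `≤ 3·coSplit + 7` letters (`card_prof_le`).  Sequel: `WalkPrefixResidueCylinders` (2/3: residue cylinders are large),
`WalkThreeStepUsableBound` (3/3: `usableBound : UsableBound`, `hubCount : HubCount`).
WHAT THIS IS NOT: not the item (modules U-c/U-d/U-e and the assembly remain); separation NOT moved.
-/

namespace Summit.QuantumAdvantage.AdviceFreeQNC0.LocalEngine

open Finset Classical

namespace RungU

variable {p n : ℕ}

/-! ### §0 Objects of architecture (U) (planner's sketch, names kept) -/

/-- Position `τ` is DEGENERATE for `(S, c)`: the adjacent transposition at `τ` never changes WIN. -/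
def Degenerate (c : ℕ) (S : ThreeStep p n) (τ : ℕ) : Prop :=
  ∀ u : Fin n → Bool, discBit3 c S τ u = false

/-- The co-split number of position `τ`: how many OTHER cuts observe `τ` (have a split at `τ`). -/
noncomputable def coSplit (S : ThreeStep p n) (τ : ℕ) : ℕ :=
  (univ.filter fun h : Fin (n + 1) => h.val ≠ τ ∧ Observes S h τ).card

/-- Number of winning inputs. -/
noncomputable def winCount (c : ℕ) (S : ThreeStep p n) : ℕ :=
  (univ.filter fun u : Fin n → Bool => ringWinU c S.y u = true).card

/-- **(U-a) USABLE BOUND** (sketch signature verbatim): one non-degenerate position of bounded co-split forces a constant loss. -/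
def UsableBound : Prop :=
  ∀ M : ℕ, ∃ η : ℝ, 0 < η ∧ ∃ m₀ : ℕ, ∀ (n c : ℕ) (S : ThreeStep 5 n) (τ : ℕ),
    m₀ ≤ τ → τ + m₀ ≤ n → coSplit S τ ≤ M → ¬ Degenerate c S τ →
      (winCount c S : ℝ) ≤ (1 - η) * 2 ^ n

/-- **(U-b) HUB COUNT** (sketch signature verbatim): positions of co-split `> M` are fewer than `2(n+1)/M`. -/
def HubCount : Prop :=
  ∀ (n M : ℕ) (S : ThreeStep 5 n), 0 < M →
    M * ((range (n + 1)).filter fun τ => M < coSplit S τ).card ≤ 2 * (n + 1)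

/-! ### §1 The discordance bit is decided by the residue profile -/

/-- A discordant input sits at a genuine transposition: `1 ≤ τ < n`. -/
theorem pos_of_discBit3 (c : ℕ) (S : ThreeStep p n) (τ : ℕ) (u : Fin n → Bool) (h : discBit3 c S τ u = true) :
    1 ≤ τ ∧ τ < n := by
  by_contra hτ
  have e : cornerFlip n τ u = u := by
    unfold cornerFlip
    rw [dif_neg hτ]
  unfold discBit3 at h
  rw [e, Bool.xor_self] at h
  exact Bool.false_ne_true h

/-- `N(x) = N(min x n)`: prefix counts beyond the end are the total weight. -/
theorem wtPrefix_min (u : Fin n → Bool) (x : ℕ) : wtPrefix u x = wtPrefix u (min x n) := by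
  unfold wtPrefix
  congr 1
  ext i
  simp only [Finset.mem_filter, Finset.mem_univ, true_and, lt_min_iff]
  constructor
  · rintro ⟨h1, h2⟩; exact ⟨⟨h1, i.isLt⟩, h2⟩
  · rintro ⟨⟨h1, _⟩, h2⟩; exact ⟨h1, h2⟩

/-- The positions (truncated at `n`) whose prefix counts cut `h` reads: its own position and its two splits. -/
def reads (S : ThreeStep p n) (h : Fin (n + 1)) : Finset ℕ :=
  {min h.val n, min (S.s h) n, min (max (S.s h) (S.t h)) n}

/-- The residue `N(x) mod m` of the prefix count of `u` at position `x` (the letters of a residue profile). -/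
def res (m : ℕ) (u : Fin n → Bool) (x : ℕ) : ℕ := wtPrefix u x % m

/-- equal residues `mod 3p` give equal casts in `ZMod p`. -/
theorem cast_eq_of_sameRes {u v : Fin n → Bool} {x : ℕ} (h : res (3 * p) u x = res (3 * p) v x) :
    ((wtPrefix u x : ℕ) : ZMod p) = ((wtPrefix v x : ℕ) : ZMod p) := by
  rw [ZMod.natCast_eq_natCast_iff']
  exact Nat.ModEq.of_mul_left 3 h

/-- equal residues `mod 3p` give equal residues `mod 3`. -/
theorem mod3_eq_of_sameRes {u v : Fin n → Bool} {x : ℕ} (h : res (3 * p) u x = res (3 * p) v x) :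
    wtPrefix u x % 3 = wtPrefix v x % 3 :=
  Nat.ModEq.of_mul_right p h

/-- **Status congruence**: the status of cut `h` is decided by the residues `mod 3p` of `N` at the positions it reads and at `n`. -/
theorem status3_congr (c : ℕ) (S : ThreeStep p n) (h : Fin (n + 1)) {u v : Fin n → Bool}
    (hr : ∀ x ∈ reads S h, res (3 * p) u x = res (3 * p) v x) (hn : res (3 * p) u n = res (3 * p) v n) :
    status3 c S h u = status3 c S h v := by
  have h1 : res (3 * p) u h.val = res (3 * p) v h.val := by
    have := hr (min h.val n) (by simp [reads]); unfold res at this ⊢; rwa [wtPrefix_min u, wtPrefix_min v]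
  have h2 : res (3 * p) u (S.s h) = res (3 * p) v (S.s h) := by
    have := hr (min (S.s h) n) (by simp [reads]); unfold res at this ⊢; rwa [wtPrefix_min u, wtPrefix_min v]
  have h3 : res (3 * p) u (max (S.s h) (S.t h)) = res (3 * p) v (max (S.s h) (S.t h)) := by
    have := hr (min (max (S.s h) (S.t h)) n) (by simp [reads]); unfold res at this ⊢
    rwa [wtPrefix_min u, wtPrefix_min v]
  have hw : ((wt u : ℕ) : ZMod p) = ((wt v : ℕ) : ZMod p) := by
    rw [Coset21.wt_eq_wtPrefix, Coset21.wt_eq_wtPrefix]; exact cast_eq_of_sameRes hn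
  have hy : S.y h u = S.y h v := by
    rw [ThreeStep.y_eq_decide, ThreeStep.y_eq_decide, cast_eq_of_sameRes h2, cast_eq_of_sameRes h3, hw]
  have hl : (c + h.val + walkExp u h.val) % 3 = (c + h.val + walkExp v h.val) % 3 := by
    unfold walkExp
    rw [Coset21.wt_eq_wtPrefix, Coset21.wt_eq_wtPrefix]
    have a := mod3_eq_of_sameRes hn
    have b := mod3_eq_of_sameRes h1
    omega
  unfold status3
  rw [hy, hl]

/-- The observers of `τ`. -/
noncomputable def obs (S : ThreeStep p n) (τ : ℕ) : Finset (Fin (n + 1)) := univ.filter fun h => Observes S h τ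

/-- The profile positions of `τ`: `τ − 1, τ, τ + 1, n` and everything an observer of `τ` reads. -/
noncomputable def prof (S : ThreeStep p n) (τ : ℕ) : Finset ℕ :=
  {τ - 1, τ, τ + 1, n} ∪ (obs S τ).biUnion fun h => reads S h

/-- the four fixed profile positions. -/
theorem mem_prof_left (S : ThreeStep p n) (τ : ℕ) {x : ℕ} (hx : x = τ - 1 ∨ x = τ ∨ x = τ + 1 ∨ x = n) : x ∈ prof S τ := by
  unfold prof
  rw [Finset.mem_union]; left
  simp only [Finset.mem_insert, Finset.mem_singleton]
  tauto

/-- what an observer reads is profiled. -/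
theorem mem_prof_reads (S : ThreeStep p n) (τ : ℕ) {h : Fin (n + 1)} (hh : Observes S h τ) {x : ℕ} (hx : x ∈ reads S h) :
    x ∈ prof S τ := by
  unfold prof
  rw [Finset.mem_union]; right
  rw [Finset.mem_biUnion]
  exact ⟨h, by unfold obs; rw [Finset.mem_filter]; exact ⟨Finset.mem_univ _, hh⟩, hx⟩

/-- the observers are the own cut plus the co-observers: `#obs ≤ coSplit + 1`. -/
theorem card_obs_le (S : ThreeStep p n) (τ : ℕ) : (obs S τ).card ≤ coSplit S τ + 1 := by
  unfold obs coSplit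
  have hsplit := Finset.card_filter_add_card_filter_not
    (s := univ.filter fun h : Fin (n + 1) => Observes S h τ) (fun h : Fin (n + 1) => h.val ≠ τ)
  rw [Finset.filter_filter, Finset.filter_filter] at hsplit
  have e1 : (univ.filter fun h : Fin (n + 1) => Observes S h τ ∧ h.val ≠ τ)
      = univ.filter fun h : Fin (n + 1) => h.val ≠ τ ∧ Observes S h τ :=
    Finset.filter_congr fun h _ => and_comm
  have e2 : (univ.filter fun h : Fin (n + 1) => Observes S h τ ∧ ¬ h.val ≠ τ).card ≤ 1 := by
    rw [Finset.card_le_one]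
    intro a ha b hb
    rw [Finset.mem_filter] at ha hb
    push Not at ha hb
    exact Fin.ext (ha.2.2.trans hb.2.2.symm)
  rw [e1] at hsplit
  omega

/-- `#prof ≤ 3·coSplit + 7`. -/
theorem card_prof_le (S : ThreeStep p n) (τ : ℕ) : (prof S τ).card ≤ 3 * coSplit S τ + 7 := by
  unfold prof
  have h1 : ({τ - 1, τ, τ + 1, n} : Finset ℕ).card ≤ 4 := Finset.card_le_four
  have h2 : ((obs S τ).biUnion fun h => reads S h).card ≤ (obs S τ).card * 3 := by
    apply Finset.card_biUnion_le_card_mul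
    intro h _
    unfold reads
    exact Finset.card_le_three
  have h3 := card_obs_le S τ
  have h4 := Finset.card_union_le ({τ - 1, τ, τ + 1, n} : Finset ℕ) ((obs S τ).biUnion fun h => reads S h)
  nlinarith

/-- The profile cylinder of `u₀` at `τ`. -/
noncomputable def cyl (S : ThreeStep p n) (τ : ℕ) (u₀ : Fin n → Bool) : Finset (Fin n → Bool) :=
  univ.filter fun u => ∀ x ∈ prof S τ, res (3 * p) u x = res (3 * p) u₀ x

/-- membership in the profile cylinder. -/
theorem mem_cyl {S : ThreeStep p n} {τ : ℕ} {u₀ u : Fin n → Bool} :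
    u ∈ cyl S τ u₀ ↔ ∀ x ∈ prof S τ, res (3 * p) u x = res (3 * p) u₀ x := by
  unfold cyl; rw [Finset.mem_filter]; simp

/-- On the cylinder the bit at a profile position `x` with `x + 1` also profiled is that of `u₀` (needs `3p ≥ 2`). -/
theorem bit_eq_of_sameRes (hp : 1 ≤ p) {u v : Fin n → Bool} {x : ℕ} (hx : x < n)
    (h0 : res (3 * p) u x = res (3 * p) v x) (h1 : res (3 * p) u (x + 1) = res (3 * p) v (x + 1)) : u ⟨x, hx⟩ = v ⟨x, hx⟩ := by
  unfold res at h0 h1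
  rw [Coset21.wtPrefix_succ u x hx, Coset21.wtPrefix_succ v x hx] at h1
  have hm : 2 ≤ 3 * p := by omega
  by_contra hne
  have key : ∀ (a b : ℕ), a % (3 * p) = b % (3 * p) → (a + 1) % (3 * p) = b % (3 * p) → False := by
    intro a b e1 e2
    have h : a + 1 ≡ a + 0 [MOD 3 * p] := by rw [Nat.add_zero]; exact e2.trans e1.symm
    have h10 : (1 : ℕ) % (3 * p) = 0 % (3 * p) := Nat.ModEq.add_left_cancel' a h
    rw [Nat.zero_mod, Nat.mod_eq_of_lt (by omega)] at h10
    exact one_ne_zero h10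
  cases hu : u ⟨x, hx⟩ <;> cases hv : v ⟨x, hx⟩
  · exact hne (hu.trans hv.symm)
  · rw [hu, hv] at h1; simp only [Bool.false_eq_true, ↓reduceIte, add_zero, ↓reduceIte] at h1
    exact key _ _ h0.symm h1.symm
  · rw [hu, hv] at h1; simp only [↓reduceIte, Bool.false_eq_true, add_zero] at h1
    exact key _ _ h0 h1
  · exact hne (hu.trans hv.symm)

/-- the transposition swaps the two corner bits. -/
theorem cornerFlip_apply_left (τ : ℕ) (u : Fin n → Bool) (h1 : 1 ≤ τ) (h2 : τ < n) :
    cornerFlip n τ u ⟨τ - 1, by omega⟩ = u ⟨τ, h2⟩ := by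
  unfold cornerFlip
  rw [dif_pos ⟨h1, h2⟩]
  simp only [Function.comp_apply, Equiv.swap_apply_left]

/-- the transposition swaps the two corner bits (right). -/
theorem cornerFlip_apply_right (τ : ℕ) (u : Fin n → Bool) (h1 : 1 ≤ τ) (h2 : τ < n) :
    cornerFlip n τ u ⟨τ, h2⟩ = u ⟨τ - 1, by omega⟩ := by
  unfold cornerFlip
  rw [dif_pos ⟨h1, h2⟩]
  simp only [Function.comp_apply, Equiv.swap_apply_right]

/-- equal corner bits: the transposition is the identity. -/
theorem cornerFlip_eq_self (τ : ℕ) (u : Fin n → Bool) (h1 : 1 ≤ τ) (h2 : τ < n)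
    (he : u ⟨τ - 1, by omega⟩ = u ⟨τ, h2⟩) : cornerFlip n τ u = u := by
  funext i
  by_cases hi1 : i.val + 1 = τ
  · have hi : i = ⟨τ - 1, by omega⟩ := Fin.ext (by simp; omega)
    rw [hi, cornerFlip_apply_left τ u h1 h2]; exact he.symm
  · by_cases hi2 : i.val = τ
    · have hi : i = ⟨τ, h2⟩ := Fin.ext (by simpa using hi2)
      rw [hi, cornerFlip_apply_right τ u h1 h2]; exact he
    · exact DensePeel.cornerFlip_apply_of_ne τ u i hi1 hi2

/-- **Profile transport**: on the cylinder of `u₀` the flipped input has the profile of the flipped `u₀`. -/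
theorem sameRes_cornerFlip (hp : 1 ≤ p) (S : ThreeStep p n) {τ : ℕ} (h1 : 1 ≤ τ) (h2 : τ < n)
    {u₀ u : Fin n → Bool} (hu : u ∈ cyl S τ u₀) {x : ℕ} (hx : x ∈ prof S τ) :
    res (3 * p) (cornerFlip n τ u) x = res (3 * p) (cornerFlip n τ u₀) x := by
  rw [mem_cyl] at hu
  by_cases hxt : x = τ
  · subst hxt
    have ea : u ⟨x - 1, by omega⟩ = u₀ ⟨x - 1, by omega⟩ := by
      have := bit_eq_of_sameRes hp (u := u) (v := u₀) (x := x - 1) (by omega)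
        (hu _ (mem_prof_left S x (Or.inl rfl))) (by rw [Nat.sub_add_cancel h1]; exact hu _ (mem_prof_left S x (Or.inr (Or.inl rfl))))
      exact this
    have eb : u ⟨x, h2⟩ = u₀ ⟨x, h2⟩ :=
      bit_eq_of_sameRes hp h2 (hu _ (mem_prof_left S x (Or.inr (Or.inl rfl))))
        (hu _ (mem_prof_left S x (Or.inr (Or.inr (Or.inl rfl)))))
    have hxx := hu x (mem_prof_left S x (Or.inr (Or.inl rfl)))
    unfold res at hxx ⊢
    -- the four corner patterns
    cases ha : u₀ ⟨x - 1, by omega⟩ <;> cases hb : u₀ ⟨x, h2⟩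
    · rw [cornerFlip_eq_self x u h1 h2 (by rw [ea, eb, ha, hb]), cornerFlip_eq_self x u₀ h1 h2 (by rw [ha, hb])]
      exact hxx
    · -- (0,1): the flip raises N(x) by one; apply the (1,0) lemma to the flipped inputs
      have k1 := DensePeel.wtPrefix_cornerFlip_self (cornerFlip n x u) x h1 h2
        (by rw [cornerFlip_apply_left x u h1 h2, eb, hb]) (by rw [cornerFlip_apply_right x u h1 h2, ea, ha])
      have k2 := DensePeel.wtPrefix_cornerFlip_self (cornerFlip n x u₀) x h1 h2
        (by rw [cornerFlip_apply_left x u₀ h1 h2, hb]) (by rw [cornerFlip_apply_right x u₀ h1 h2, ha])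
      rw [cornerFlip_cornerFlip] at k1 k2
      rw [← k1, ← k2]
      exact Nat.ModEq.add_right 1 hxx
    · -- (1,0): the flip lowers N(x) by one
      have k1 := DensePeel.wtPrefix_cornerFlip_self u x h1 h2 (by rw [ea, ha]) (by rw [eb, hb])
      have k2 := DensePeel.wtPrefix_cornerFlip_self u₀ x h1 h2 ha hb
      rw [← k1, ← k2] at hxx
      exact Nat.ModEq.add_right_cancel' 1 hxx
    · rw [cornerFlip_eq_self x u h1 h2 (by rw [ea, eb, ha, hb]), cornerFlip_eq_self x u₀ h1 h2 (by rw [ha, hb])]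
      exact hxx
  · unfold res
    rw [wtPrefix_cornerFlip τ u hxt, wtPrefix_cornerFlip τ u₀ hxt]
    exact hu x hx

/-- discordance as a parity of status changes. -/
theorem discBit3_eq_true_iff_odd_card (c : ℕ) (S : ThreeStep p n) (τ : ℕ) (u : Fin n → Bool) :
    discBit3 c S τ u = true ↔
      Odd ((univ.filter fun h : Fin (n + 1) => status3 c S h u ≠ status3 c S h (cornerFlip n τ u)).card) := by
  unfold discBit3
  rw [xor_eq_true_iff_odd_add (ringWinU_eq_true_iff_odd_sum3 c S u) (ringWinU_eq_true_iff_odd_sum3 c S _),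
    ← Finset.sum_add_distrib]
  exact DensePeel.odd_sum_toNat_add_iff _ _ _

/-- **The discordance bit is a function of the residue profile.** -/
theorem discBit3_congr (hp : 1 ≤ p) (c : ℕ) (S : ThreeStep p n) {τ : ℕ} (h1 : 1 ≤ τ) (h2 : τ < n)
    {u₀ u : Fin n → Bool} (hu : u ∈ cyl S τ u₀) : discBit3 c S τ u = discBit3 c S τ u₀ := by
  have hset : (univ.filter fun h : Fin (n + 1) => status3 c S h u ≠ status3 c S h (cornerFlip n τ u))
      = univ.filter fun h : Fin (n + 1) => status3 c S h u₀ ≠ status3 c S h (cornerFlip n τ u₀) := by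
    apply Finset.filter_congr
    intro h _
    by_cases ho : Observes S h τ
    · have hu' := (mem_cyl.mp hu)
      have e1 : status3 c S h u = status3 c S h u₀ :=
        status3_congr c S h (fun x hx => hu' x (mem_prof_reads S τ ho hx)) (hu' n (mem_prof_left S τ (by tauto)))
      have e2 : status3 c S h (cornerFlip n τ u) = status3 c S h (cornerFlip n τ u₀) :=
        status3_congr c S h (fun x hx => sameRes_cornerFlip hp S h1 h2 hu (mem_prof_reads S τ ho hx))
          (sameRes_cornerFlip hp S h1 h2 hu (mem_prof_left S τ (by tauto)))
      rw [e1, e2]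
    · rw [status3_cornerFlip_of_not_observes c S h τ u ho, status3_cornerFlip_of_not_observes c S h τ u₀ ho]
      simp
  rw [Bool.eq_iff_iff, discBit3_eq_true_iff_odd_card, discBit3_eq_true_iff_odd_card, hset]

/-- On the cylinder the two corner bits are those of `u₀`. -/
theorem bits_eq_of_mem_cyl (hp : 1 ≤ p) (S : ThreeStep p n) {τ : ℕ} (h1 : 1 ≤ τ) (h2 : τ < n)
    {u₀ u : Fin n → Bool} (hu : u ∈ cyl S τ u₀) :
    u ⟨τ - 1, by omega⟩ = u₀ ⟨τ - 1, by omega⟩ ∧ u ⟨τ, h2⟩ = u₀ ⟨τ, h2⟩ := by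
  rw [mem_cyl] at hu
  refine ⟨?_, ?_⟩
  · have := bit_eq_of_sameRes hp (u := u) (v := u₀) (x := τ - 1) (by omega)
      (hu _ (mem_prof_left S τ (Or.inl rfl)))
      (by rw [Nat.sub_add_cancel h1]; exact hu _ (mem_prof_left S τ (Or.inr (Or.inl rfl))))
    exact this
  · exact bit_eq_of_sameRes hp h2 (hu _ (mem_prof_left S τ (Or.inr (Or.inl rfl))))
      (hu _ (mem_prof_left S τ (Or.inr (Or.inr (Or.inl rfl)))))


end RungU

end Summit.QuantumAdvantage.AdviceFreeQNC0.LocalEngine
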